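import Mathlib
import Summits.Ventures.HodgeRepro2.T5CharactersTrivialOnBase
import Summits.Ventures.HodgeRepro2.T5AdicCompletionRelativeDuality
import Summits.Ventures.HodgeRepro2.T5InertConductorShift
import Summits.Ventures.HodgeRepro2.T5InertNormalizedCharacter
import Summits.Ventures.HodgeRepro2.T5LocalNormIndex
import Summits.Ventures.HodgeRepro2.T6N5TateTwist
import Summits.Ventures.HodgeRepro2.T6N5Hyp
import Summits.Ventures.HodgeRepro2.T6N5LocalDatum
import Summits.Ventures.HodgeRepro2.T6N5LocalHyp
import Summits.Ventures.HodgeRepro2.T6N5Local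
import Summits.Ventures.HodgeRepro2.T6N5LocalCharDatum
import Summits.Ventures.HodgeRepro2.T6N5LocalInertHyp
import Summits.Ventures.HodgeRepro2.T6N5LocalInert
import Summits.Ventures.HodgeRepro2.T6N5LocalInertCompletion
import Summits.Ventures.HodgeRepro2.T6N5LocalInertOnCompletion
import Summits.Ventures.HodgeRepro2.T6N5LocalOnCompletionIndex
import Summits.Ventures.HodgeRepro2.T6N5LocalTateChars

/-!
# T6N5LocalInertTateSide — Tier 6, M2 sub-step N5 (t6-p8's half): LAYER III FOR THE TATE SIDE at an inert place

The inert assembly `T6N5LocalOnCompletionIndex.N5Local_main_inert_completion'` takes the Tate side of the datum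
as a bundle of PARAMETERS `T : TateSide L_wˣ` (the additive characters `Psi`, the Haar measures `Meas`, `ω_s`,
`‖·‖`, `ψ_a`, the scalings, the self-dual measures, Tate's `ε(χ, ψ, dx)`, `ψ_δ`, the inert / normalised predicates,
`ψ₀`, `t`, `d_v`) together with the CONDITIONS `hc` (the normalisation conventions), `hψδ : ψ_δ = ψ₀(t·)`,
`ht : t ∈ F_v^×`, `hηt : η_v(t) = (−1)^{d_v+1}`, `hin`, `hψ0 : ψ₀ normalised`. With the additive characters, the absolute value, `ω_s`, the Haar measures and the self-dual
measures modelled in `T6N5LocalTateChars` (`PsiC`, `twist`, `cond`, `nrm`, `omega`, `sd`, `TateParams`), this file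
models the remaining Tate-side fields at an INERT place and proves all six conditions:
* `Psi` := the continuous non-trivial additive characters of `L_w` (`PsiC`); `ψ_a` := `ψ(a·)` (`twist`);
  `n(ψ)` := the exact conductor (`cond`: `ψ` trivial on `B(c) = 𝔭^{−c}`, not on `B(c + 1)` — p4's `exists_conductor`),
  with the twisting rule `n(ψ(a·)) = n(ψ) − log v(a)` (`cond_twist`, from p4's `T5BallCharacters`);
* `Meas` := `ℝ` (the multiples of a fixed Haar measure), `r · dx := r dx`; `‖a‖ := q_E^{log v(a)} = q_E^{−ord(a)}`
  (`nrm`, `q_E` the residue cardinality), `ω_s := ‖·‖^s` (`omega`), `dx_ψ := q_E^{−n(ψ)/2}` (`sd`) — so that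
  `Conventions` (`ω_s(a) = ‖a‖^s`, `‖a‖ > 0`, `dx_{ψ_a} = ‖a‖^{1/2} dx_ψ`) is a THEOREM (`conventions_mk`);
* `ψ₀` := p4's normalised character (`exists_char_trivial_on_base_conductor_neg_one'`: continuous, trivial on `K_v`
  and on `𝔭_E`, non-trivial on `O_E` — Proposition 3.1's normalisation, `IsNormalisedC`), `hψ0` a theorem;
* for the datum's `ψ_δ` — a continuous non-trivial character of `L_w` trivial on `K_v` (`ψ_δ = ψ_F ∘ tr(δ ·)`,
  `tr δ = 0`) — `t` := the unique `t ∈ K_v` with `ψ_δ = ψ₀(t·)` and `d_v := n(ψ_δ)`, from p4's relative duality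
  and conductor shift (`exists_unique_log_val_eq`: `log v(t) = −1 − d_v`); `hψδ`, `ht`, `hηt` theorems
  (`η_v(t) = (−1)^{log v(t)}` through `μ_eq_ηF` / `μ_apply` of `T6N5LocalInertCompletion`);
* `IsInert` := `[L_w : K_v] = 2 ∧ ϖ irreducible in O_{L_w}` (the place data), `hin` a theorem.
What stays parametric: `epsT` (Tate's ε-factor — no Mathlib model) with its displays `hT` (Tate (3.2.2)–(3.2.3)),
`hG` (GGP-ex Prop. 3.1) and `h35` (BFGYYZ Thm 3.5), and the Weil-side data (`χ_W`, `ϵ_δ(W)`, `Θ`, the line signs) with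
the (A1) / Weil inputs — bundled as `TateParams`. `N5Local_main_inert_completion_tate` is Theorem N5.T2 at an inert
place with the Tate side so modelled.
README §8(d): uses an L-value-free non-vanishing device: NO.
-/

namespace Summit.Ventures.HodgeRepro2.T6.N5LocalInertTateSide

open Summit.Ventures.HodgeRepro2 IsDedekindDomain HeightOneSpectrum
  Summit.Ventures.HodgeRepro2.T6.N5LocalDatum Summit.Ventures.HodgeRepro2.T6.N5LocalCharDatum
  Summit.Ventures.HodgeRepro2.T6.N5LocalInertDatum Summit.Ventures.HodgeRepro2.T6.N5Local
  Summit.Ventures.HodgeRepro2.T6.Hyp Summit.Ventures.HodgeRepro2.T6.N5LocalInertCompletion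
  Summit.Ventures.HodgeRepro2.T6.N5LocalInertOnCompletion
  Summit.Ventures.HodgeRepro2.T6.N5LocalOnCompletionIndex Summit.Ventures.HodgeRepro2.T6.N5LocalTateChars

-- `K`, `L` in `Type` (universe `0`): `CharDatum.E : Type`, `TateSide.Psi : Type`.
variable {K : Type} [Field K] [NumberField K] (v : HeightOneSpectrum (NumberField.RingOfIntegers K))
  {L : Type} [Field L] [NumberField L] [Algebra K L] (w : HeightOneSpectrum (NumberField.RingOfIntegers L))
  [w.asIdeal.LiesOver v.asIdeal]
  [ContinuousSMul (v.adicCompletion K) (w.adicCompletion L)]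
  [IsScalarTower K (v.adicCompletion K) (w.adicCompletion L)]

noncomputable section

/-! ### Proposition 3.1's normalisation, the normalised `ψ₀`, and `ψ_δ = ψ₀(t·)` -/

/-- Proposition 3.1's normalisation: «`ψ` is trivial on both `k_0` and the maximal ideal of `A_k`, but is
nontrivial on `A_k`» — trivial on `K_v`, trivial on `B(−1) = 𝔭_E`, non-trivial on `B(0) = O_E`. -/
def IsNormalisedC (ψ : PsiC w) : Prop :=
  (∀ a : v.adicCompletion K, ψ.1 (algebraMap (v.adicCompletion K) (w.adicCompletion L) a) = 1) ∧
    (∀ y, Valued.v y ≤ WithZero.exp (-1) → ψ.1 y = 1) ∧ ∃ y, Valued.v y ≤ WithZero.exp 0 ∧ ψ.1 y ≠ 1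

variable (h2 : Module.finrank (v.adicCompletion K) (w.adicCompletion L) = 2)
  {ϖ : v.adicCompletionIntegers K} (hϖ : Irreducible ϖ)
  (hϖS : Irreducible (algebraMap (v.adicCompletionIntegers K) (w.adicCompletionIntegers L) ϖ))

/-- The normalised `ψ₀` of Lemma N5.L5 (p4's `exists_char_trivial_on_base_conductor_neg_one'`). -/
def ψ0 : AddChar (w.adicCompletion L) Circle :=
  Classical.choose (T5InertNormalizedCharacter.exists_char_trivial_on_base_conductor_neg_one' v w h2 hϖ hϖS)

omit [IsScalarTower K (v.adicCompletion K) (w.adicCompletion L)] in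
/-- The defining properties of `ψ₀`. -/
theorem ψ0_spec : Continuous (ψ0 v w h2 hϖ hϖS) ∧
    (∀ a : v.adicCompletion K,
      ψ0 v w h2 hϖ hϖS (algebraMap (v.adicCompletion K) (w.adicCompletion L) a) = 1) ∧
    (∀ y, Valued.v y ≤ WithZero.exp (-1) → ψ0 v w h2 hϖ hϖS y = 1) ∧
    ∃ y, Valued.v y ≤ WithZero.exp 0 ∧ ψ0 v w h2 hϖ hϖS y ≠ 1 :=
  Classical.choose_spec
    (T5InertNormalizedCharacter.exists_char_trivial_on_base_conductor_neg_one' v w h2 hϖ hϖS)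

omit [IsScalarTower K (v.adicCompletion K) (w.adicCompletion L)] in
/-- `ψ₀ ≠ 1`. -/
theorem ψ0_ne_one : ψ0 v w h2 hϖ hϖS ≠ 1 := by
  obtain ⟨-, -, -, y, -, hy⟩ := ψ0_spec v w h2 hϖ hϖS
  intro h
  apply hy
  rw [h, AddChar.one_apply]

/-- `ψ₀` as an element of `PsiC`. -/
def ψ0C : PsiC w := ⟨ψ0 v w h2 hϖ hϖS, (ψ0_spec v w h2 hϖ hϖS).1, ψ0_ne_one v w h2 hϖ hϖS⟩

omit [IsScalarTower K (v.adicCompletion K) (w.adicCompletion L)] in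
/-- `ψ₀` is normalised. -/
theorem isNormalisedC_ψ0C : IsNormalisedC v w (ψ0C v w h2 hϖ hϖS) :=
  (ψ0_spec v w h2 hϖ hϖS).2

variable (σ : Gal(w.adicCompletion L/v.adicCompletion K)) (hσ : σ ≠ 1)

/-- A basis `(1, θ)` of `L_w` over `K_v` (p4's `exists_basis_forall_existsUnique`). -/
def basisB : Module.Basis (Fin 2) (v.adicCompletion K) (w.adicCompletion L) :=
  Classical.choose (T5AdicCompletionRelativeDuality.exists_basis_forall_existsUnique v w h2 σ hσ)

omit [ContinuousSMul (v.adicCompletion K) (w.adicCompletion L)]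
  [IsScalarTower K (v.adicCompletion K) (w.adicCompletion L)] in
/-- `basisB 0 = 1`. -/
theorem basisB_zero : basisB v w h2 σ hσ 0 = 1 :=
  (Classical.choose_spec
    (T5AdicCompletionRelativeDuality.exists_basis_forall_existsUnique v w h2 σ hσ)).1

omit [IsScalarTower K (v.adicCompletion K) (w.adicCompletion L)] in
/-- `ψ₀ = ofBase (1, θ) (toBase (1, θ) ψ₀)`: the normalised character is of the relative-duality form. -/
theorem ofBase_toBase_ψ0 :
    T5CharactersTrivialOnBase.ofBase (basisB v w h2 σ hσ)
      (T5CharactersTrivialOnBase.toBase (basisB v w h2 σ hσ) (ψ0 v w h2 hϖ hϖS)) = ψ0 v w h2 hϖ hϖS :=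
  T5CharactersTrivialOnBase.ofBase_toBase _ (basisB_zero v w h2 σ hσ) _ (ψ0_spec v w h2 hϖ hϖS).2.1

omit [IsScalarTower K (v.adicCompletion K) (w.adicCompletion L)] in
/-- `toBase (1, θ) ψ₀` is continuous. -/
theorem continuous_toBase_ψ0 :
    Continuous (T5CharactersTrivialOnBase.toBase (basisB v w h2 σ hσ) (ψ0 v w h2 hϖ hϖS)) :=
  T5AdicCompletionRelativeDuality.continuous_toBase v w _ _ (ψ0_spec v w h2 hϖ hϖS).1

omit [IsScalarTower K (v.adicCompletion K) (w.adicCompletion L)] in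
/-- `toBase (1, θ) ψ₀ ≠ 1`. -/
theorem toBase_ψ0_ne_one :
    T5CharactersTrivialOnBase.toBase (basisB v w h2 σ hσ) (ψ0 v w h2 hϖ hϖS) ≠ 1 := fun h =>
  ψ0_ne_one v w h2 hϖ hϖS
    ((T5CharactersTrivialOnBase.eq_one_iff_toBase_eq_one _ (basisB_zero v w h2 σ hσ) _
      (ψ0_spec v w h2 hϖ hϖS).2.1).mpr h)

omit [IsScalarTower K (v.adicCompletion K) (w.adicCompletion L)] in
include σ hσ in
/-- For the datum's `ψ_δ` (continuous, non-trivial, trivial on `K_v`): there is a unique `t ∈ K_v` with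
`ψ_δ = ψ₀(t·)`, and `log v(t) = −1 − n(ψ_δ)` (p4's `exists_unique_log_val_eq` at `c₀ = −1`). -/
theorem existsUnique_t (ψδ : PsiC w)
    (hK : ∀ a : v.adicCompletion K, ψδ.1 (algebraMap (v.adicCompletion K) (w.adicCompletion L) a) = 1) :
    ∃! t : v.adicCompletion K,
      (∀ y, ψδ.1 y = ψ0 v w h2 hϖ hϖS (algebraMap (v.adicCompletion K) (w.adicCompletion L) t * y)) ∧
        (Valued.v t).log = -1 - cond w ψδ := by
  have h := T5InertConductorShift.exists_unique_log_val_eq v w hϖ hϖS (basisB v w h2 σ hσ)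
    (basisB_zero v w h2 σ hσ) _ (continuous_toBase_ψ0 v w h2 hϖ hϖS σ hσ)
    (toBase_ψ0_ne_one v w h2 hϖ hϖS σ hσ) (c₀ := -1)
    (by rw [ofBase_toBase_ψ0]; exact (ψ0_spec v w h2 hϖ hϖS).2.2.1)
    (by rw [ofBase_toBase_ψ0]; simpa using (ψ0_spec v w h2 hϖ hϖS).2.2.2)
    ψδ.1 ψδ.2.1 hK (d := cond w ψδ) (cond_spec w ψδ).1 (cond_spec w ψδ).2
  simpa only [ofBase_toBase_ψ0] using h

/-- `t ∈ K_v` with `ψ_δ = ψ₀(t·)`. -/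
def tK (ψδ : PsiC w)
    (hK : ∀ a : v.adicCompletion K, ψδ.1 (algebraMap (v.adicCompletion K) (w.adicCompletion L) a) = 1) :
    v.adicCompletion K :=
  Classical.choose (existsUnique_t v w h2 hϖ hϖS σ hσ ψδ hK).exists

omit [IsScalarTower K (v.adicCompletion K) (w.adicCompletion L)] in
/-- The defining property of `tK`. -/
theorem tK_spec (ψδ : PsiC w)
    (hK : ∀ a : v.adicCompletion K, ψδ.1 (algebraMap (v.adicCompletion K) (w.adicCompletion L) a) = 1) :
    (∀ y, ψδ.1 y = ψ0 v w h2 hϖ hϖS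
      (algebraMap (v.adicCompletion K) (w.adicCompletion L) (tK v w h2 hϖ hϖS σ hσ ψδ hK) * y)) ∧
      (Valued.v (tK v w h2 hϖ hϖS σ hσ ψδ hK)).log = -1 - cond w ψδ :=
  Classical.choose_spec (existsUnique_t v w h2 hϖ hϖS σ hσ ψδ hK).exists

omit [IsScalarTower K (v.adicCompletion K) (w.adicCompletion L)] in
/-- `t ≠ 0` (else `ψ_δ = 1`). -/
theorem tK_ne_zero (ψδ : PsiC w)
    (hK : ∀ a : v.adicCompletion K, ψδ.1 (algebraMap (v.adicCompletion K) (w.adicCompletion L) a) = 1) :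
    tK v w h2 hϖ hϖS σ hσ ψδ hK ≠ 0 := by
  intro h0
  apply ψδ.2.2
  refine AddChar.ext _ _ fun y => ?_
  rw [(tK_spec v w h2 hϖ hϖS σ hσ ψδ hK).1 y, h0, map_zero, zero_mul, AddChar.map_zero_eq_one,
    AddChar.one_apply]

/-- `t` as a unit of `L_w` (in `F_v^×`). -/
def tE (ψδ : PsiC w)
    (hK : ∀ a : v.adicCompletion K, ψδ.1 (algebraMap (v.adicCompletion K) (w.adicCompletion L) a) = 1) :
    (w.adicCompletion L)ˣ :=
  T5UnramifiedCharacter.baseUnits v w (Units.mk0 _ (tK_ne_zero v w h2 hϖ hϖS σ hσ ψδ hK))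

omit [IsScalarTower K (v.adicCompletion K) (w.adicCompletion L)] in
/-- `t ∈ F_v^×`. -/
theorem tE_mem_Fsub (ψδ : PsiC w)
    (hK : ∀ a : v.adicCompletion K, ψδ.1 (algebraMap (v.adicCompletion K) (w.adicCompletion L) a) = 1) :
    tE v w h2 hϖ hϖS σ hσ ψδ hK ∈ Fsub v w :=
  ⟨_, rfl⟩

omit [IsScalarTower K (v.adicCompletion K) (w.adicCompletion L)] in
/-- The value of `tE` in `L_w` is the image of `tK`. -/
theorem coe_tE (ψδ : PsiC w)
    (hK : ∀ a : v.adicCompletion K, ψδ.1 (algebraMap (v.adicCompletion K) (w.adicCompletion L) a) = 1) :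
    ((tE v w h2 hϖ hϖS σ hσ ψδ hK : (w.adicCompletion L)ˣ) : w.adicCompletion L) =
      algebraMap (v.adicCompletion K) (w.adicCompletion L) (tK v w h2 hϖ hϖS σ hσ ψδ hK) := rfl

omit [IsScalarTower K (v.adicCompletion K) (w.adicCompletion L)] in
/-- `ψ_δ = ψ₀(t·)`: the datum condition `hψδ`. -/
theorem ψδ_eq_twist (ψδ : PsiC w)
    (hK : ∀ a : v.adicCompletion K, ψδ.1 (algebraMap (v.adicCompletion K) (w.adicCompletion L) a) = 1) :
    ψδ = twist w (ψ0C v w h2 hϖ hϖS) (tE v w h2 hϖ hϖS σ hσ ψδ hK) := by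
  refine Subtype.ext (AddChar.ext _ _ fun y => ?_)
  rw [twist_apply, coe_tE]
  exact (tK_spec v w h2 hϖ hϖS σ hσ ψδ hK).1 y

omit [IsScalarTower K (v.adicCompletion K) (w.adicCompletion L)] in
/-- `η_v(t) = (−1)^{d_v + 1}` with `d_v = n(ψ_δ)`: the datum condition `hηt` (`η_v(t) = (−1)^{log v(t)}` at an
inert place through `μ_eq_ηF`, and `log v(t) = −1 − d_v`). -/
theorem ηF_tE (ψδ : PsiC w)
    (hK : ∀ a : v.adicCompletion K, ψδ.1 (algebraMap (v.adicCompletion K) (w.adicCompletion L) a) = 1) :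
    ((ηF v w σ (T5LocalNormIndex.index_normGroup_eq_two v w σ h2 hσ)
      ⟨tE v w h2 hϖ hϖS σ hσ ψδ hK, tE_mem_Fsub v w h2 hϖ hϖS σ hσ ψδ hK⟩ : ℂˣ) : ℂ) =
      (-1 : ℂ) ^ (cond w ψδ + 1) := by
  rw [← μ_eq_ηF v w σ hσ h2 hϖ hϖS, μ_apply, coe_tE, T5InertConductorShift.val_algebraMap_eq v w hϖ hϖS,
    (tK_spec v w h2 hϖ hϖS σ hσ ψδ hK).2, Units.val_zpow_eq_zpow_val, Units.val_neg, Units.val_one]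
  have h : (-1 - cond w ψδ : ℤ) = -(cond w ψδ + 1) := by ring
  rw [h, zpow_neg]
  rcases Int.even_or_odd (cond w ψδ + 1) with he | ho
  · rw [he.neg_one_zpow, inv_one]
  · rw [ho.neg_one_zpow]
    norm_num

/-! ### The Tate side, modelled -/

/-- The Tate side of the inert datum on Mathlib's completions: every field modelled except the ε-factor and the
Weil-side parameters `P`, for the datum's `ψ_δ` (continuous, non-trivial, trivial on `K_v`). -/
def mkTateSide (P : TateParams (w.adicCompletion L)ˣ (PsiC w) ℝ) (ψδ : PsiC w)
    (hK : ∀ a : v.adicCompletion K, ψδ.1 (algebraMap (v.adicCompletion K) (w.adicCompletion L) a) = 1) :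
    TateSide (w.adicCompletion L)ˣ where
  Psi := PsiC w
  Meas := ℝ
  omega := omega w
  nrm := nrm w
  tw := twist w
  sc := fun r m => r * m
  sd := sd w
  epsT := P.epsT
  ψδ := ψδ
  χW := P.χW
  epsdW := P.epsdW
  Theta := P.Theta
  ηLine := P.ηLine
  ηu := P.ηu
  IsInert := Module.finrank (v.adicCompletion K) (w.adicCompletion L) = 2 ∧
    Irreducible (algebraMap (v.adicCompletionIntegers K) (w.adicCompletionIntegers L) ϖ)
  IsNormalised := IsNormalisedC v w
  ψ0 := ψ0C v w h2 hϖ hϖS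
  t := tE v w h2 hϖ hϖS σ hσ ψδ hK
  d := cond w ψδ

omit [IsScalarTower K (v.adicCompletion K) (w.adicCompletion L)] in
/-- The normalisation conventions hold on the modelled Tate side: `ω_s(a) = ‖a‖^s`, `‖a‖ > 0`,
`dx_{ψ_a} = ‖a‖^{1/2} dx_ψ`. -/
theorem conventions_mk (P : TateParams (w.adicCompletion L)ˣ (PsiC w) ℝ) (ψδ : PsiC w)
    (hK : ∀ a : v.adicCompletion K, ψδ.1 (algebraMap (v.adicCompletion K) (w.adicCompletion L) a) = 1) :
    (mkInert v w ϖ σ (T5LocalNormIndex.index_normGroup_eq_two v w σ h2 hσ)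
      (mkTateSide v w h2 hϖ hϖS σ hσ P ψδ hK)).toCharDatum.Conventions where
  ev_omega s a := omega_apply w s a
  nrm_pos a := nrm_pos w a
  sd_tw ψ a := sd_twist w ψ a

/-- THEOREM N5.T2 AT AN INERT PLACE WITH THE TATE SIDE MODELLED: `N5Local_main_inert_completion'` on
`mkTateSide`, with `hc`, `hψδ`, `ht`, `hηt`, `hin`, `hψ0` discharged. Hypotheses: the place data, the datum's `ψ_δ`
(continuous, non-trivial, trivial on `K_v`), the parameters `P` with the displays `hG` (GGP-ex Prop. 3.1), `hT`
(Tate (3.2.2)–(3.2.3) for `P.epsT` with the modelled `ψ_a`, `r·dx`, `‖·‖`), `h35` (BFGYYZ Thm 3.5), and the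
(A1) / Weil-side inputs `hA1`, `hW`, `hχW`. -/
theorem N5Local_main_inert_completion_tate
    (hf : 2 ≤ (Ideal.span {ϖ}).inertiaDeg'
      (Ideal.span {algebraMap (v.adicCompletionIntegers K) (w.adicCompletionIntegers L) ϖ}))
    (P : TateParams (w.adicCompletion L)ˣ (PsiC w) ℝ) (ψδ : PsiC w)
    (hK : ∀ a : v.adicCompletion K, ψδ.1 (algebraMap (v.adicCompletion K) (w.adicCompletion L) a) = 1)
    (hG : GGP2012ex_Prop3_1 (mkInert v w ϖ σ (T5LocalNormIndex.index_normGroup_eq_two v w σ h2 hσ)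
      (mkTateSide v w h2 hϖ hϖS σ hσ P ψδ hK)))
    (hT : Tate1979_3_2_2_3 P.epsT (fun ξ a => ((ξ a : ℂˣ) : ℂ)) (twist w) (fun r m => r * m) (nrm w)
      (fun _ => True))
    (h35 : BFGYYZ2025_Thm3_5 (mkInert v w ϖ σ (T5LocalNormIndex.index_normGroup_eq_two v w σ h2 hσ)
      (mkTateSide v w h2 hϖ hϖS σ hσ P ψδ hK)).toLocalSignDatum)
    (hA1 : ∀ s : ℤˣ, ∃ α : (w.adicCompletion L)ˣ →* ℂˣ,
      (mkInert v w ϖ σ (T5LocalNormIndex.index_normGroup_eq_two v w σ h2 hσ)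
        (mkTateSide v w h2 hϖ hϖS σ hσ P ψδ hK)).toLocalSignDatum.IsCO α ∧ P.Theta s α)
    (hW : P.epsdW = 1)
    (hχW : (mkInert v w ϖ σ (T5LocalNormIndex.index_normGroup_eq_two v w σ h2 hσ)
      (mkTateSide v w h2 hϖ hϖS σ hσ P ψδ hK)).toLocalSignDatum.IsCS P.χW) :
    ∃ ξ : Fin 4 → (w.adicCompletion L)ˣ →* ℂˣ,
      LocalSolution (mkInert v w ϖ σ (T5LocalNormIndex.index_normGroup_eq_two v w σ h2 hσ)
        (mkTateSide v w h2 hϖ hϖS σ hσ P ψδ hK)).toLocalSignDatum ξ :=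
  N5Local_main_inert_completion' v w hϖ hϖS hf h2 σ hσ (mkTateSide v w h2 hϖ hϖS σ hσ P ψδ hK) hG hT
    (conventions_mk v w h2 hϖ hϖS σ hσ P ψδ hK) (ψδ_eq_twist v w h2 hϖ hϖS σ hσ ψδ hK)
    (tE_mem_Fsub v w h2 hϖ hϖS σ hσ ψδ hK) (ηF_tE v w h2 hϖ hϖS σ hσ ψδ hK) ⟨h2, hϖS⟩
    (isNormalisedC_ψ0C v w h2 hϖ hϖS) h35 hA1 hW hχW

end

end Summit.Ventures.HodgeRepro2.T6.N5LocalInertTateSide
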